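import Mathlib
import HarnessLib
import Summits.ValiantsHypothesis.ValiantsHypothesis.Theses.MonotoneRestoration
import Literature.Computability.AlgebraicComplexity.ArithCircuit
import Literature.Computability.AlgebraicComplexity.ArithCircuitProofs
import Literature.Computability.AlgebraicComplexity.MonotoneStructure
import Literature.Computability.AlgebraicComplexity.PermanentIrreducible
import Literature.ModelTheory.FiniteModelTheory.CkEquiv
import Summits.ValiantsHypothesis.ValiantsHypothesis.Theorems.MonotoneRestorationMonotoneRestorationQPCosetCount
import Summits.ValiantsHypothesis.ValiantsHypothesis.Theorems.MonotoneRestorationMonotoneRestorationQPSymmetricLB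
import Summits.ValiantsHypothesis.ValiantsHypothesis.Theorems.MonotoneRestorationMonotoneRestorationQPSupportSymmetrisation
import Summits.ValiantsHypothesis.ValiantsHypothesis.Theorems.MonotoneRestorationMonotoneRestorationQPSparseRegime
import Summits.ValiantsHypothesis.ValiantsHypothesis.Theorems.MonotoneRestorationMonotoneRestorationQPBeta
import Literature.Computability.AlgebraicComplexity.SymmetricArithCircuit
import Literature.Computability.AlgebraicComplexity.DawarWilsenach2025Proofs
import Literature.GroupTheory.PermutationGroups.SmallIndexSubgroups
import Summits.ValiantsHypothesis.ValiantsHypothesis.Theorems.MonotoneRestorationQP.Negative.LoadBearing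
import Summits.ValiantsHypothesis.ValiantsHypothesis.Theorems.MonotoneRestorationMonotoneRestorationQPPermSupportCount
import Summits.ValiantsHypothesis.ValiantsHypothesis.Theorems.MonotoneRestorationMonotoneRestorationQPVariants19213

/-! TTRL-lite variant V19206 of stmt-ValiantsHypothesis-15886 -/

-- `Summit.ValiantsHypothesis.ValiantsHypothesis.…` is the tree's mandated single-conjunct layout
-- (Sub = Summit), so the duplicated namespace component is intended.
set_option linter.dupNamespace false

namespace Summit.ValiantsHypothesis.ValiantsHypothesis.Theorems

open Summit.ValiantsHypothesis.ValiantsHypothesis.Theses.MonotoneRestoration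
open Literature.Computability.AlgebraicComplexity

/-- TTRL-lite variant V19206 (boundary probe, REFUTED): `e₂` of the row sums
`R_i = Σ_j x_{i,j}` of the `4 × 4` variable matrix over `ℝ≥0` is NOT column-multilinear
(column degrees written as `rowDegrees` of the `Prod.swap`-ped exponent).  Witness: the monomial
`x_{0,0} x_{1,0}` has coefficient `1` (tree lemma `stub_esymmRowSums_structure_var19213`), hence
lies in the support, and its column-`0` degree is `2`.  So the witness polynomial of the route is
row- but not column-multilinear (Theorem β, the bi-multilinear slice, does not apply to it). -/
theorem stub_esymmRowSums_structure_var19206_false :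
    ¬ (∀ m ∈ (MvPolynomial.bind₁ (fun i : Fin 4 => ∑ j : Fin 4, MvPolynomial.X (i, j))
        (MvPolynomial.esymm (Fin 4) NNReal 2)).support,
      ∀ j : Fin 4, rowDegrees (Finsupp.mapDomain Prod.swap m) j ≤ 1) := by
  intro h
  -- the witness monomial `x_{0,0} x_{1,0}` lies in the support (its coefficient is `1`)
  have hmem : Finsupp.single ((0 : Fin 4), (0 : Fin 4)) 1 + Finsupp.single ((1 : Fin 4), (0 : Fin 4)) 1 ∈
      (MvPolynomial.bind₁ (fun i : Fin 4 => ∑ j : Fin 4, MvPolynomial.X (i, j))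
        (MvPolynomial.esymm (Fin 4) NNReal 2)).support := by
    rw [MvPolynomial.mem_support_iff, stub_esymmRowSums_structure_var19213]
    exact one_ne_zero
  -- but its column-`0` degree is `2`
  have h2 := h _ hmem 0
  simp [rowDegrees, Finsupp.mapDomain_add, Finsupp.mapDomain_single] at h2

end Summit.ValiantsHypothesis.ValiantsHypothesis.Theorems
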